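import Literature.LinearAlgebra.IdempotentRankOfCharpolyFactorisation
import Mathlib.LinearAlgebra.Charpoly.BaseChange
import Mathlib.LinearAlgebra.Eigenspace.Charpoly
import Mathlib.LinearAlgebra.Eigenspace.Minpoly
import Mathlib.FieldTheory.IsAlgClosed.AlgebraicClosure
import HarnessLib

/-!
# Split-root lifting: a characteristic polynomial over a ring `R₀` which factorises in split root form at ONE point `R₀ → κ`, for an
# endomorphism annihilated by the split separable polynomial `∏ (X − c_i)` at an injective point `R₀ ↪ E`, factorises the same way at that point
# ([Kottwitz 1992] §5 p. 390 determinant condition; [Görtz–Wedhorn I] Rem. 6.12; linear algebra)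

Topic `Literature/LinearAlgebra`; namespace `Literature.LinearAlgebra` (continues ★ `IdempotentRankOfCharpolyFactorisation` (A-p18 (g30)), whose
`rootMultiplicity_prod_X_sub_C_pow` is the multiplicity bookkeeping used here).  THEOREMS ONLY (no definition, no named fact, no `instance`, no notation, no
`sorry`).  Cell `hodgecm-mathlib` (D-0151), FLOOR 0, P6 «MOD programme», `stub_RGD` ledger row (vi)(U1) piece (U1-c) under LEAD «M-17m′» (door (E)) and
«(U1-c″)» 2026-09-01 21:17:51Z — the LOCAL-RING ROAD brick **(L3) «SPLIT-ROOT LIFTING»**: with `R₀ := 𝒪_{Z,z′}` (a local ring of the smooth connected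
record curve), `f := R₀ ↪ κ(η)` (generic point), `g := R₀ → κ(z′)` (closed point), `χ := lieCharpoly_{R₀}(ι a)`, `v := cotangentMap (A_η) (ι_η a)` (A-p17
(g26)՚s (B1) «family ↔ fibre» supplies `χ.map f = v.charpoly` and `χ.map g =` the closed-fibre charpoly), this turns «Kottwitz in split root form at the
closed point `z′`» into «Kottwitz in split root form at the generic point `η`».  `--supports stmt-HodgeConjecture-24832`, count-neutral: HC_CM is proved only
modulo the 2 remaining named inputs (hLiu418 24832, h413 24833) until rung 0 closes; nothing here is about HC.

THE MATHEMATICS.  `R₀` a commutative ring, `f : R₀ → E` INJECTIVE into a field, `g : R₀ → κ` any ring map to a field; `V` a finite-dimensional `E`-space,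
`v ∈ End_E(V)` with `v.charpoly = χ^f` for some `χ ∈ R₀[X]`; roots `c : ι → R₀` on a finite index set `s` with `g ∘ c` injective on `s`, multiplicities
`m : ι → ℕ`; HYPOTHESES: `(∏_{i∈s} (X − f c_i))(v) = 0` (e.g. `v = ι(a)` and `∏ (X − c_i) =` the minimal polynomial of `a`, split in `R₀`) and
`χ^g = ∏_{i∈s} (X − g c_i)^{m_i}` (Kottwitz at the point `g`).  CONCLUSION: `v.charpoly = ∏_{i∈s} (X − f c_i)^{m_i}` (Kottwitz at the point `f`).
PROOF.  Over an algebraic closure `Ē`, `v.charpoly` splits; each root `μ` is an eigenvalue of `v_Ē` (Mathlib `hasEigenvalue_iff_isRoot_charpoly`), and on an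
eigenvector the annihilating product acts by `∏ (μ − f c_i)`, so `μ ∈ f(c(s))`; regrouping the roots, `v.charpoly = ∏ (X − f c_i)^{n_i}` with
`n_i :=` the multiplicity of `f c_i` (in `Ē[X]`, then in `E[X]` by injectivity of `E → Ē`); by injectivity of `f`, `χ = ∏ (X − c_i)^{n_i}` in `R₀[X]`;
applying `g` and comparing root multiplicities at the DISTINCT `g c_i` with the hypothesis (★ `rootMultiplicity_prod_X_sub_C_pow`) gives `n_i = m_i` on `s`.

* §1 `aeval_baseChange_map_eq_zero` (annihilation survives base change), `mem_image_of_isRoot_charpoly_baseChange` (roots of the characteristic polynomial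
  lie among the roots of a split annihilator), `charpoly_baseChange_eq_prod_pow_count`, **`exists_charpoly_eq_prod_X_sub_C_pow`** (step 1: SOME exponents);
* §2 `exponent_eq_of_prod_X_sub_C_pow_eq` (exponents are determined at distinct roots), **`exists_eq_prod_of_map_eq_charpoly`** (`χ` itself factorises over `R₀`),
  HEAD **`charpoly_eq_prod_of_map_eq_prod`** and its `χ`-form **`eq_prod_of_map_eq_prod`**.

## References
* [Kottwitz1992] R. Kottwitz, *Points on some Shimura varieties over finite fields*, JAMS 5 (1992), §5 p. 390 (determinant condition).
* [GortzWedhorn2020] U. Görtz, T. Wedhorn, *Algebraic Geometry I*, 2nd ed. (2020), Remark 6.12 (2)–(3).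
* [Lang2002] S. Lang, *Algebra*, rev. 3rd ed. (2002), Ch. XIV §3 (characteristic polynomial, eigenvalues), Ch. IV §1 (roots and multiplicities).
-/

set_option autoImplicit false

noncomputable section

open Polynomial Module

namespace Literature.LinearAlgebra

universe u v w

/-! ## §0 Polynomial algebra -/

/-- A product of powers of linear factors maps factorwise. [cite: GortzWedhorn2020, Remark 6.12 (2)–(3)] -/
theorem map_prod_X_sub_C_pow' {R S : Type*} [CommRing R] [CommRing S] (φ : R →+* S) {ι' : Type*} (t : Finset ι') (e : ι' → R) (m : ι' → ℕ) :
    (∏ i ∈ t, (X - C (e i)) ^ m i).map φ = ∏ i ∈ t, (X - C (φ (e i))) ^ m i := by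
  rw [Polynomial.map_prod]
  refine Finset.prod_congr rfl fun i _ => ?_
  rw [Polynomial.map_pow, Polynomial.map_sub, Polynomial.map_X, Polynomial.map_C]

/-! ## §1 The characteristic polynomial of an endomorphism killed by a split separable polynomial is a product of powers of its factors -/

section Roots

variable {E : Type u} [Field E] {V : Type v} [AddCommGroup V] [Module E V] [FiniteDimensional E V] (v : Module.End E V)
  {ι : Type w} (s : Finset ι) (d : ι → E)

omit [FiniteDimensional E V] in
/-- Annihilation by a polynomial survives base change of the field: `p(v) = 0 ⇒ p^A(v_A) = 0`. [cite: GortzWedhorn2020, Remark 6.12 (2)–(3)] -/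
theorem aeval_baseChange_map_eq_zero (A : Type u) [CommRing A] [Algebra E A] {p : E[X]} (hp : aeval v p = 0) :
    aeval (v.baseChange A) (p.map (algebraMap E A)) = 0 := by
  rw [aeval_map_algebraMap, show v.baseChange A = Module.End.baseChangeHom E A V v from rfl, aeval_algHom_apply, hp, map_zero]

/-- **The roots of the characteristic polynomial lie among the roots of a split annihilator**: if `(∏_{i∈s} (X − d_i))(v) = 0` then every root (in any field
extension `A`) of `v.charpoly` is one of the `d_i` — it is an eigenvalue of `v_A`, and on an eigenvector the annihilator acts by `∏ (μ − d_i)`.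
[cite: Lang2002, Ch. XIV §3] -/
theorem mem_image_of_isRoot_charpoly_baseChange [DecidableEq E] (A : Type u) [Field A] [Algebra E A] [DecidableEq A]
    (hann : aeval v (∏ i ∈ s, (X - C (d i))) = 0) {μ : A} (hμ : (v.baseChange A).charpoly.IsRoot μ) :
    μ ∈ s.image fun i => algebraMap E A (d i) := by
  rw [← Module.End.hasEigenvalue_iff_isRoot_charpoly] at hμ
  obtain ⟨x, hx⟩ := hμ.exists_hasEigenvector
  have h := Module.End.aeval_apply_of_hasEigenvector (p := (∏ i ∈ s, (X - C (d i))).map (algebraMap E A)) hx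
  rw [aeval_baseChange_map_eq_zero v A hann, LinearMap.zero_apply, Polynomial.eval_map_algebraMap, map_prod] at h
  simp only [map_sub, aeval_X, aeval_C] at h
  have h0 : ∏ i ∈ s, (μ - algebraMap E A (d i)) = 0 := by
    rcases smul_eq_zero.mp h.symm with h0 | hx0
    · exact h0
    · exact absurd hx0 hx.2
  obtain ⟨i, hi, h0i⟩ := Finset.prod_eq_zero_iff.mp h0
  exact Finset.mem_image.mpr ⟨i, hi, (sub_eq_zero.mp h0i).symm⟩

/-- Over an algebraically closed extension `A`, `v_A.charpoly = ∏_{i∈s} (X − d_i)^{#roots at d_i}` when `(∏ (X − d_i))(v) = 0` and `d` is injective on `s`.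
[cite: Lang2002, Ch. XIV §3] -/
theorem charpoly_baseChange_eq_prod_pow_count [DecidableEq E] (A : Type u) [Field A] [Algebra E A] [IsAlgClosed A] [DecidableEq A]
    (hinj : Set.InjOn d s) (hann : aeval v (∏ i ∈ s, (X - C (d i))) = 0) :
    (v.baseChange A).charpoly = ∏ i ∈ s, (X - C (algebraMap E A (d i))) ^ (v.baseChange A).charpoly.roots.count (algebraMap E A (d i)) := by
  set Q := (v.baseChange A).charpoly with hQ
  have hsplit : Q.Splits := IsAlgClosed.splits Q
  have hmonic : Q.Monic := LinearMap.charpoly_monic _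
  -- regroup the multiset of roots
  have h1 : Q = ∏ μ ∈ Q.roots.toFinset, (X - C μ) ^ Q.roots.count μ := by
    conv_lhs => rw [hsplit.eq_prod_roots_of_monic hmonic]
    exact Finset.prod_multiset_map_count Q.roots (fun μ => X - C μ)
  -- every root is some `d_i`
  have hsub : Q.roots.toFinset ⊆ s.image fun i => algebraMap E A (d i) := by
    intro μ hμ
    rw [Multiset.mem_toFinset, mem_roots hmonic.ne_zero] at hμ
    exact mem_image_of_isRoot_charpoly_baseChange v s d A hann hμ
  have h2 : ∏ μ ∈ Q.roots.toFinset, (X - C μ) ^ Q.roots.count μ = ∏ μ ∈ s.image (fun i => algebraMap E A (d i)), (X - C μ) ^ Q.roots.count μ := by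
    refine Finset.prod_subset hsub fun μ _ hμ => ?_
    rw [Multiset.mem_toFinset] at hμ
    rw [Multiset.count_eq_zero_of_notMem hμ, pow_zero]
  have hinj' : Set.InjOn (fun i => algebraMap E A (d i)) s := fun i hi j hj h =>
    hinj hi hj ((algebraMap E A).injective h)
  calc Q = ∏ μ ∈ Q.roots.toFinset, (X - C μ) ^ Q.roots.count μ := h1
    _ = ∏ μ ∈ s.image (fun i => algebraMap E A (d i)), (X - C μ) ^ Q.roots.count μ := h2
    _ = ∏ i ∈ s, (X - C (algebraMap E A (d i))) ^ Q.roots.count (algebraMap E A (d i)) := Finset.prod_image hinj'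

/-- **STEP 1 — SOME exponents**: if `(∏_{i∈s} (X − d_i))(v) = 0` with `d` injective on `s`, then `v.charpoly = ∏_{i∈s} (X − d_i)^{n_i}` for some `n : ι → ℕ`
(descend from an algebraic closure by injectivity of `E[X] → Ē[X]`). [cite: Lang2002, Ch. XIV §3] -/
theorem exists_charpoly_eq_prod_X_sub_C_pow (hinj : Set.InjOn d s) (hann : aeval v (∏ i ∈ s, (X - C (d i))) = 0) :
    ∃ n : ι → ℕ, v.charpoly = ∏ i ∈ s, (X - C (d i)) ^ n i := by
  classical
  let A := AlgebraicClosure E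
  have key := charpoly_baseChange_eq_prod_pow_count v s d A hinj hann
  refine ⟨fun i => (v.baseChange A).charpoly.roots.count (algebraMap E A (d i)), ?_⟩
  apply Polynomial.map_injective (algebraMap E A) (algebraMap E A).injective
  rw [map_prod_X_sub_C_pow', ← LinearMap.charpoly_baseChange]
  exact key

end Roots

/-! ## §2 Lifting the exponents from one point to the ring, and the head -/

section Lift

variable {R₀ : Type u} [CommRing R₀] {E : Type u} [Field E] {κ : Type v} [Field κ] (f : R₀ →+* E) (g : R₀ →+* κ)
  {ι : Type w} (s : Finset ι) (c : ι → R₀)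

/-- **Exponents are determined at DISTINCT roots** (over a domain): `∏_{i∈s} (X − e_i)^{n_i} = ∏_{i∈s} (X − e_i)^{m_i}` with `e` injective on `s` forces
`n = m` on `s` (compare root multiplicities, ★ `rootMultiplicity_prod_X_sub_C_pow`). [cite: Lang2002, Ch. IV §1] -/
theorem exponent_eq_of_prod_X_sub_C_pow_eq {D : Type*} [CommRing D] [IsDomain D] [DecidableEq D] [DecidableEq ι] (e : ι → D) (hinj : Set.InjOn e s)
    {n m : ι → ℕ} (h : ∏ i ∈ s, (X - C (e i)) ^ n i = ∏ i ∈ s, (X - C (e i)) ^ m i) {j : ι} (hj : j ∈ s) : n j = m j := by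
  have key := congrArg (fun p : D[X] => p.rootMultiplicity (e j)) h
  simp only [rootMultiplicity_prod_X_sub_C_pow] at key
  have hfilter : (s.filter fun i => e i = e j) = {j} := by
    ext i
    simp only [Finset.mem_filter, Finset.mem_singleton]
    exact ⟨fun ⟨hi, hei⟩ => hinj hi hj hei, fun hij => ⟨hij ▸ hj, by rw [hij]⟩⟩
  simpa [hfilter] using key

/-- **`χ` ITSELF FACTORISES OVER `R₀`**: if `f : R₀ ↪ E` is injective, `χ^f = v.charpoly`, and `(∏_{i∈s} (X − f c_i))(v) = 0` with `f ∘ c` injective on `s`,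
then `χ = ∏_{i∈s} (X − c_i)^{n_i}` in `R₀[X]` for some `n`. [cite: Lang2002, Ch. XIV §3] -/
theorem exists_eq_prod_of_map_eq_charpoly (hf : Function.Injective f) (χ : R₀[X]) {V : Type v} [AddCommGroup V] [Module E V] [FiniteDimensional E V]
    (v : Module.End E V) (hχ : χ.map f = v.charpoly) (hinj : Set.InjOn (fun i => f (c i)) s)
    (hann : aeval v (∏ i ∈ s, (X - C (f (c i)))) = 0) : ∃ n : ι → ℕ, χ = ∏ i ∈ s, (X - C (c i)) ^ n i := by
  obtain ⟨n, hn⟩ := exists_charpoly_eq_prod_X_sub_C_pow v s (fun i => f (c i)) hinj hann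
  refine ⟨n, Polynomial.map_injective f hf ?_⟩
  rw [hχ, hn, map_prod_X_sub_C_pow']

/-- **SPLIT-ROOT LIFTING, `χ`-form**: `f : R₀ ↪ E` injective into a field, `g : R₀ → κ` any point, `χ^f = v.charpoly` with `(∏_{i∈s} (X − f c_i))(v) = 0`,
`g ∘ c` injective on `s`, and `χ^g = ∏_{i∈s} (X − g c_i)^{m_i}` ⟹ `χ = ∏_{i∈s} (X − c_i)^{m_i}` in `R₀[X]`. [cite: Kottwitz1992, §5 p. 390] [cite: Lang2002, Ch. XIV §3] -/
theorem eq_prod_of_map_eq_prod (hf : Function.Injective f) (χ : R₀[X]) {V : Type v} [AddCommGroup V] [Module E V] [FiniteDimensional E V]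
    (v : Module.End E V) (hχ : χ.map f = v.charpoly) (m : ι → ℕ) (hinj : Set.InjOn (fun i => g (c i)) s)
    (hann : aeval v (∏ i ∈ s, (X - C (f (c i)))) = 0) (hκ : χ.map g = ∏ i ∈ s, (X - C (g (c i))) ^ m i) :
    χ = ∏ i ∈ s, (X - C (c i)) ^ m i := by
  classical
  have hinjc : Set.InjOn c s := fun i hi j hj h => hinj hi hj (by simp only [h])
  have hinjf : Set.InjOn (fun i => f (c i)) s := fun i hi j hj h => hinjc hi hj (hf h)
  obtain ⟨n, hn⟩ := exists_eq_prod_of_map_eq_charpoly f s c hf χ v hχ hinjf hann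
  have hg : ∏ i ∈ s, (X - C (g (c i))) ^ n i = ∏ i ∈ s, (X - C (g (c i))) ^ m i := by
    rw [← hκ, hn, map_prod_X_sub_C_pow']
  rw [hn]
  exact Finset.prod_congr rfl fun j hj => by rw [exponent_eq_of_prod_X_sub_C_pow_eq s (fun i => g (c i)) hinj hg hj]

/-- **SPLIT-ROOT LIFTING (HEAD)** — «Kottwitz in split root form at the point `g` ⟹ at the injective point `f`»: under the hypotheses of `eq_prod_of_map_eq_prod`,
`v.charpoly = ∏_{i∈s} (X − f c_i)^{m_i}`.  (Consumer: `R₀ = 𝒪_{Z,z′}`, `f` = generic point, `g` = closed point, `χ = lieCharpoly (ι a)`, `v = cotangentMap (ι_η a)`,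
`∏ (X − c_i) = μ_a` split in `Fᵢ ⊆ R₀`.) [cite: Kottwitz1992, §5 p. 390] [cite: GortzWedhorn2020, Remark 6.12 (2)–(3)] -/
theorem charpoly_eq_prod_of_map_eq_prod (hf : Function.Injective f) (χ : R₀[X]) {V : Type v} [AddCommGroup V] [Module E V] [FiniteDimensional E V]
    (v : Module.End E V) (hχ : χ.map f = v.charpoly) (m : ι → ℕ) (hinj : Set.InjOn (fun i => g (c i)) s)
    (hann : aeval v (∏ i ∈ s, (X - C (f (c i)))) = 0) (hκ : χ.map g = ∏ i ∈ s, (X - C (g (c i))) ^ m i) :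
    v.charpoly = ∏ i ∈ s, (X - C (f (c i))) ^ m i := by
  rw [← hχ, eq_prod_of_map_eq_prod f g s c hf χ v hχ m hinj hann hκ, map_prod_X_sub_C_pow']

end Lift

end Literature.LinearAlgebra

end
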